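/-
Copyright (c) 2026 the pub-hodgecm-mathlib formalisation cell (harness21).  Prover seat hodgecm-mathlib-F0P3b-p01 (g17): line LH3 (closer stub `stub_N9`), LETTER L1 clause (I₁),
brick (X-core) «CROSS CORNER × A REAL WALL AT A SPLIT PLACE» (LH3-plan (g4) DEAL 2026-09-02T12:00:29Z; road owner LH5-p02 (g4)), layer L2^E «FINSET `E` HELD OUT» in the
PRODUCT-OF-LOCAL-QUOTIENTS form asked by the binder of record (LH5-p02 12:08:17Z) — part 1 (the `chartOrbG` half).
-/
import Literature.NumberTheory.Rogawski1990.ArchChartOrbGHeldOut   -- ★ p851278 (this seat): §0 generic `measurePreserving_prodLeftComm` ∕ `integral_prod_prodLeftComm` ∕ `integrable_prodLeftComm_iff`; brings ★ (A1) p850949, ★ (A4) `forall_mem_pi_chartTorusGLoc_comm`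
import HarnessLib

/-!
# `chartOrbG` WITH A FINSET `E` OF COMPACT PLACES HELD OUT AS THE PRODUCT OF THEIR LOCAL QUOTIENTS (Folland 1995 §2.6 (2.52); Rogawski 1990 §8.2–8.3)

Topic `NumberTheory/Rogawski1990`; namespace `Literature.NumberTheory.Automorphic.UnitaryGroup`.  THEOREMS ONLY (no `def`, no `instance`, no notation, no axiom, no named fact,
no `sorry`); kernel lane `--kind proof --supports stmt-HodgeConjecture-24833`.  Cell `pub/hodgecm-mathlib`, crux H413 (`stmt-HodgeConjecture-24833`), F0∕P3c line LH3 (closer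
stub `stub_N9`), LETTER L1 `HcOrbitalFamiliesStatement`, clause (I₁), organ O-L1e-b «cross corner × a real wall at a split place» ((X-core) road: L1^ι LH5-p02 over ★ L1 LH1-p03,
L2^E this seat, L3^E + head LH5-p02 (g4)).  Sibling of ★ p851424 `ArchChartOrbGHeldOutFinset` (which holds `E` out as ONE quotient of the product group): here the held-out places
stay a PRODUCT `Π_{w ∉ S′, w ∈ E} (U_w ⧸ T′_w)` of LOCAL quotients against `⊗ q_w` — the shape L1^ι `exists_descent_box_local_param_pi` consumes (induction over the held-out places on
`Measure.pi`), with NO extra Haar datum on the `E`-side.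

CONVENTIONS (`W` = complex places, `U_w = U(α)_w`, `T′_w = chartTorusGLoc α w S′`, `γ_w(c) = gprimeBlockAt α w S′ (c w)`, `e = archPiEquivCM`, `q_w = ν′_w ∕ t_w`): `E : Finset W`
ARBITRARY (places of `S′` take the split branch first; no disjointness binder); indices `ιE = {w : {w // w ∉ S′} // w.1 ∈ E}`, `ιR = {w : {w // w ∉ S′} // w.1 ∉ E}` (read into L1^ι ∕ ★ (A4′)
with `e := fun w => w.1.1`); `M_R = Π_{ιR} T′_w`, `X_R = (Π_{ιR} U_w) ⧸ M_R` with Weil quotient measure `Q_R = (⊗_{ιR} ν′_w) ∕ ρ_R` (`ρ_R` inversion-invariant Haar on `M_R` with coordinates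
`⊗ t_w`, ★ `exists_haar_map_subgroupPiCoords_eq_pi`).  The point of `Π_w U_w` is a plain three-way `dite`, the `E`-slot in LOCAL `descConj (γ_w(c)) T′_w _ id (z ⟨⟨w,_⟩,_⟩)` currency
(no `Function.update`, no junk branch, no transport).
* §1 `exists_measurableEquiv_heldOutFinsetPi` — `Φ : (Π_{S′} U⧸T′) × (Π_{∉S′} U⧸T′) ≃ᵐ (Π_{S′} U⧸T′) × ((Π_{ιE} U⧸T′) × X_R)`, measure preserving
  `(⊗_{S′} q) ⊗ (⊗_{∉S′} q) → (⊗_{S′} q) ⊗ ((⊗_{ιE} q) ⊗ Q_R)` (Mathlib `piEquivPiSubtypeProd` at `w.1 ∈ E`; ★ `map_quotientPiHomeomorph_quotientMeasure_pi` on the rest only);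
  `heldOutFinsetPi_point_eq`; **`chartOrbG_eq_prod_mul_integral_pi_prod_heldOutFinsetPi`** — HYPOTHESIS-FREE:
  `chartOrbG ν′ S′ a′ c = (∏_w t_w(B′_w)) · ∫ a′ (e⁻¹ (w ↦ [w ∈ S′] x_w γ_w(c) x_w⁻¹ ∣ [w ∈ E] z_w γ_w(c) z_w⁻¹ ∣ [else] (g γ_R(c) g⁻¹)_w)) d((⊗_{S′} q) ⊗ ((⊗_{ιE} q) ⊗ Q_R))` — every `a′`, every `c`.
* §2 at a `G`-REGULAR `c` and `a′ ∈ C_c(G′_∞)`: `integrable_heldOutFinsetPi_of_regG` and the ITERATED form **`chartOrbG_eq_prod_mul_integral_integral_heldOutFinsetPi_of_regG`** — the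
  `E`-variables OUTSIDE: `… = (∏ t(B′)) · ∫_{Π_{ιE} U⧸T′} ( ∫_{(Π_{S′} U⧸T′) × X_R} … ) d(⊗_{ιE} q)`.
HONEST LABEL: HC_CM is proved only modulo the 7 printed citations (2 remaining named inputs: hLiu418 = `stmt-HodgeConjecture-24832`, h413 = `stmt-HodgeConjecture-24833`) until rung 0
closes; count-neutral letter-L1 plumbing.

## References
* [Folland1995] G. B. Folland, *A Course in Abstract Harmonic Analysis* (1995), §2.2, §2.6 Thm. 2.49, (2.52).
* [Gelbart1975] S. Gelbart, *Automorphic Forms on Adele Groups*, Ann. of Math. Studies 83 (1975), §10 p. 155 (10.19); [Rogawski1990] J. D. Rogawski, *Automorphic Representations of Unitary Groups in Three Variables*, Ann. of Math. Stud. 123 (1990), §8.2 p. 122, §8.3 pp. 122–124.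
* [DeitmarEchterhoff2014] A. Deitmar, S. Echterhoff, *Principles of Harmonic Analysis*, 2nd ed. (2014), Thm. 1.5.3, Lemma 9.3.3.
-/

set_option autoImplicit false

noncomputable section
open MeasureTheory MeasureTheory.Measure Set NumberField NumberField.InfinitePlace Complex Topology
open Literature.MeasureTheory.Group Literature.NumberTheory.Rogawski1990 Literature.NumberTheory.Automorphic Literature.NumberTheory.Automorphic.UnitaryGroup
open Literature.NumberTheory.Automorphic.ArchCartan
open scoped ContDiff Classical ENNReal NNReal MatrixGroups

namespace Literature.NumberTheory.Automorphic.UnitaryGroup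

/-! ## §1 `chartOrbG` with a finset `E` held out as the product of its local quotients — hypothesis-free -/
section HeldOutFinsetPi
variable (L : Type) [Field L] [NumberField L] [IsCMField L] (α : Fin 3 → L) (S' : Finset {w : InfinitePlace L // IsComplex w})
  [∀ w : {w : InfinitePlace L // IsComplex w}, MeasurableSpace ↥(archLocal L 3 (Matrix.diagonal α) w)]
  [∀ w : {w : InfinitePlace L // IsComplex w}, BorelSpace ↥(archLocal L 3 (Matrix.diagonal α) w)]
  [∀ w : {w : InfinitePlace L // IsComplex w}, LocallyCompactSpace ↥(archLocal L 3 (Matrix.diagonal α) w)]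
  [∀ w : {w : InfinitePlace L // IsComplex w}, SecondCountableTopology ↥(archLocal L 3 (Matrix.diagonal α) w)]
  [MeasurableSpace ↥(arch (↥(maximalRealSubfield L)) L (IsCMField.complexConj L) 3 (Matrix.diagonal α))]
  [BorelSpace ↥(arch (↥(maximalRealSubfield L)) L (IsCMField.complexConj L) 3 (Matrix.diagonal α))]
  [∀ w : {w : InfinitePlace L // IsComplex w}, MeasurableSpace (↥(archLocal L 3 (Matrix.diagonal α) w) ⧸ chartTorusGLoc L α w S')]
  [∀ w : {w : InfinitePlace L // IsComplex w}, BorelSpace (↥(archLocal L 3 (Matrix.diagonal α) w) ⧸ chartTorusGLoc L α w S')]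
  (ν'w : ∀ w : {w : InfinitePlace L // IsComplex w}, Measure ↥(archLocal L 3 (Matrix.diagonal α) w)) [∀ w, (ν'w w).IsHaarMeasure] [∀ w, (ν'w w).IsMulRightInvariant]
  (ν' : Measure ↥(arch (↥(maximalRealSubfield L)) L (IsCMField.complexConj L) 3 (Matrix.diagonal α))) [ν'.IsHaarMeasure] [ν'.IsMulRightInvariant]
  (hν : ν' = (Measure.pi ν'w).map (archPiEquivCM 3 L (Matrix.diagonal α)).symm)
  (t : ∀ w : {w : InfinitePlace L // IsComplex w}, Measure ↥(chartTorusGLoc L α w S')) [∀ w, (t w).IsHaarMeasure] [∀ w, (t w).IsInvInvariant]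
  -- the held-out finset `E`: `E`-factor the PRODUCT of the local quotients `Π_{w ∉ S′, w ∈ E} (U_w ⧸ T′_w)`, rest factor ONE quotient `(Π_{w ∉ S′, w ∉ E} U_w) ⧸ Π T′_w`
  (E : Finset {w : InfinitePlace L // IsComplex w})
  [MeasurableSpace ((∀ w : {w : {w : {w : InfinitePlace L // IsComplex w} // w ∉ S'} // w.1 ∉ E}, ↥(archLocal L 3 (Matrix.diagonal α) w.1.1)) ⧸
            Subgroup.pi Set.univ (fun w : {w : {w : {w : InfinitePlace L // IsComplex w} // w ∉ S'} // w.1 ∉ E} => chartTorusGLoc L α w.1.1 S'))]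
  [BorelSpace ((∀ w : {w : {w : {w : InfinitePlace L // IsComplex w} // w ∉ S'} // w.1 ∉ E}, ↥(archLocal L 3 (Matrix.diagonal α) w.1.1)) ⧸
            Subgroup.pi Set.univ (fun w : {w : {w : {w : InfinitePlace L // IsComplex w} // w ∉ S'} // w.1 ∉ E} => chartTorusGLoc L α w.1.1 S'))]
  (ρR : Measure ↥(Subgroup.pi Set.univ (fun w : {w : {w : {w : InfinitePlace L // IsComplex w} // w ∉ S'} // w.1 ∉ E} => chartTorusGLoc L α w.1.1 S')))
  [ρR.IsHaarMeasure] [ρR.IsInvInvariant]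
  (hρR : Measure.map (subgroupPiCoords fun w : {w : {w : {w : InfinitePlace L // IsComplex w} // w ∉ S'} // w.1 ∉ E} => chartTorusGLoc L α w.1.1 S') ρR =
    Measure.pi fun w : {w : {w : {w : InfinitePlace L // IsComplex w} // w ∉ S'} // w.1 ∉ E} => t w.1.1)

omit [MeasurableSpace ↥(arch (↥(maximalRealSubfield L)) L (IsCMField.complexConj L) 3 (Matrix.diagonal α))]
  [BorelSpace ↥(arch (↥(maximalRealSubfield L)) L (IsCMField.complexConj L) 3 (Matrix.diagonal α))] in
include hρR in
/-- **THE HELD-OUT COORDINATES, `E` AS A PRODUCT OF LOCAL QUOTIENTS** — a measure-preserving equivalence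
`Φ : (Π_{w∈S′} U_w⧸T′_w) × (Π_{w∉S′} U_w⧸T′_w) ≃ᵐ (Π_{w∈S′} U_w⧸T′_w) × ((Π_{ιE} U_w⧸T′_w) × X_R)` from `(⊗_{S′} q_w) ⊗ (⊗_{∉S′} q_w)` to `(⊗_{S′} q_w) ⊗ ((⊗_{ιE} q_w) ⊗ Q_R)` READING
`Φ(x).1 = x.1`, `Φ(x).2.1 = x.2|_E`, `Φ(x).2.2 = qπ_R⁻¹ (x.2|_R)` (`qπ` = ★ `quotientPiHomeomorph`): Mathlib `piEquivPiSubtypeProd` at `w.1 ∈ E` on the compact half,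
★ `map_quotientPiHomeomorph_quotientMeasure_pi` (`hρR`) on the rest half. [cite: Folland1995, §2.2; §2.6 Thm. 2.49, (2.52)] -/
theorem exists_measurableEquiv_heldOutFinsetPi :
    ∃ Φ : ((∀ w : {w : {w : InfinitePlace L // IsComplex w} // w ∈ S'}, ↥(archLocal L 3 (Matrix.diagonal α) w.1) ⧸ chartTorusGLoc L α w.1 S') ×
        (∀ w : {w : {w : InfinitePlace L // IsComplex w} // w ∉ S'}, ↥(archLocal L 3 (Matrix.diagonal α) w.1) ⧸ chartTorusGLoc L α w.1 S')) ≃ᵐ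
      ((∀ w : {w : {w : InfinitePlace L // IsComplex w} // w ∈ S'}, ↥(archLocal L 3 (Matrix.diagonal α) w.1) ⧸ chartTorusGLoc L α w.1 S') ×
        ((∀ w : {w : {w : {w : InfinitePlace L // IsComplex w} // w ∉ S'} // w.1 ∈ E}, ↥(archLocal L 3 (Matrix.diagonal α) w.1.1) ⧸ chartTorusGLoc L α w.1.1 S') ×
          ((∀ w : {w : {w : {w : InfinitePlace L // IsComplex w} // w ∉ S'} // w.1 ∉ E}, ↥(archLocal L 3 (Matrix.diagonal α) w.1.1)) ⧸
            Subgroup.pi Set.univ (fun w : {w : {w : {w : InfinitePlace L // IsComplex w} // w ∉ S'} // w.1 ∉ E} => chartTorusGLoc L α w.1.1 S')))),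
      MeasurePreserving Φ
        ((Measure.pi fun w : {w : {w : InfinitePlace L // IsComplex w} // w ∈ S'} =>
          quotientMeasure (chartTorusGLoc L α w.1 S') (t w.1) (isClosed_chartTorusGLoc L α w.1 S') (ν'w w.1)).prod
        (Measure.pi fun w : {w : {w : InfinitePlace L // IsComplex w} // w ∉ S'} =>
          quotientMeasure (chartTorusGLoc L α w.1 S') (t w.1) (isClosed_chartTorusGLoc L α w.1 S') (ν'w w.1)))
        ((Measure.pi fun w : {w : {w : InfinitePlace L // IsComplex w} // w ∈ S'} =>
          quotientMeasure (chartTorusGLoc L α w.1 S') (t w.1) (isClosed_chartTorusGLoc L α w.1 S') (ν'w w.1)).prod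
        ((Measure.pi fun w : {w : {w : {w : InfinitePlace L // IsComplex w} // w ∉ S'} // w.1 ∈ E} =>
            quotientMeasure (chartTorusGLoc L α w.1.1 S') (t w.1.1) (isClosed_chartTorusGLoc L α w.1.1 S') (ν'w w.1.1)).prod
          (quotientMeasure (Subgroup.pi Set.univ (fun w : {w : {w : {w : InfinitePlace L // IsComplex w} // w ∉ S'} // w.1 ∉ E} => chartTorusGLoc L α w.1.1 S')) ρR
            (isClosed_coe_pi _ fun w => isClosed_chartTorusGLoc L α w.1.1 S')
            (Measure.pi fun w : {w : {w : {w : InfinitePlace L // IsComplex w} // w ∉ S'} // w.1 ∉ E} => ν'w w.1.1)))) ∧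
      ∀ x, (Φ x).1 = x.1 ∧ (Φ x).2.1 = (fun w : {w : {w : {w : InfinitePlace L // IsComplex w} // w ∉ S'} // w.1 ∈ E} => x.2 w.1) ∧
        (Φ x).2.2 = (quotientPiHomeomorph fun w : {w : {w : {w : InfinitePlace L // IsComplex w} // w ∉ S'} // w.1 ∉ E} => chartTorusGLoc L α w.1.1 S').symm (fun w : {w : {w : {w : InfinitePlace L // IsComplex w} // w ∉ S'} // w.1 ∉ E} => x.2 w.1) := by
  haveI : ∀ w : {w : InfinitePlace L // IsComplex w}, IsClosed (chartTorusGLoc L α w S' : Set ↥(archLocal L 3 (Matrix.diagonal α) w)) :=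
    fun w => isClosed_chartTorusGLoc L α w S'
  haveI : ∀ w : {w : InfinitePlace L // IsComplex w}, SecondCountableTopology (↥(archLocal L 3 (Matrix.diagonal α) w) ⧸ chartTorusGLoc L α w S') := fun w => inferInstance
  haveI : ∀ w : {w : InfinitePlace L // IsComplex w},
      SigmaFinite (quotientMeasure (chartTorusGLoc L α w S') (t w) (isClosed_chartTorusGLoc L α w S') (ν'w w)) := fun w => inferInstance
  haveI : ∀ w, LocallyCompactSpace ↥(chartTorusGLoc L α w S') := fun w => locallyCompactSpace_chartTorusGLoc L α w S'
  haveI : ∀ w, SecondCountableTopology ↥(chartTorusGLoc L α w S') := fun w => TopologicalSpace.Subtype.secondCountableTopology _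
  haveI : ∀ w, SigmaFinite (t w) := fun w => inferInstance
  have hMcR : IsClosed ((Subgroup.pi Set.univ (fun w : {w : {w : {w : InfinitePlace L // IsComplex w} // w ∉ S'} // w.1 ∉ E} => chartTorusGLoc L α w.1.1 S')) :
      Set (∀ w : {w : {w : {w : InfinitePlace L // IsComplex w} // w ∉ S'} // w.1 ∉ E}, ↥(archLocal L 3 (Matrix.diagonal α) w.1.1))) :=
    isClosed_coe_pi _ fun w => isClosed_chartTorusGLoc L α w.1.1 S'
  haveI : LocallyCompactSpace ↥(Subgroup.pi Set.univ (fun w : {w : {w : {w : InfinitePlace L // IsComplex w} // w ∉ S'} // w.1 ∉ E} => chartTorusGLoc L α w.1.1 S')) :=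
    hMcR.isClosedEmbedding_subtypeVal.locallyCompactSpace
  haveI : SecondCountableTopology ↥(Subgroup.pi Set.univ (fun w : {w : {w : {w : InfinitePlace L // IsComplex w} // w ∉ S'} // w.1 ∉ E} => chartTorusGLoc L α w.1.1 S')) :=
    TopologicalSpace.Subtype.secondCountableTopology _
  haveI : SFinite ρR := inferInstance
  have hsplit := measurePreserving_piEquivPiSubtypeProd'
    (fun w : {w : {w : InfinitePlace L // IsComplex w} // w ∉ S'} =>
      quotientMeasure (chartTorusGLoc L α w.1 S') (t w.1) (isClosed_chartTorusGLoc L α w.1 S') (ν'w w.1))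
    (fun w : {w : {w : InfinitePlace L // IsComplex w} // w ∉ S'} => w.1 ∈ E)
  have hqR : MeasurePreserving (quotientPiHomeomorph fun w : {w : {w : {w : InfinitePlace L // IsComplex w} // w ∉ S'} // w.1 ∉ E} => chartTorusGLoc L α w.1.1 S').symm.toMeasurableEquiv
      (Measure.pi fun w : {w : {w : {w : InfinitePlace L // IsComplex w} // w ∉ S'} // w.1 ∉ E} =>
        quotientMeasure (chartTorusGLoc L α w.1.1 S') (t w.1.1) (isClosed_chartTorusGLoc L α w.1.1 S') (ν'w w.1.1))
      (quotientMeasure (Subgroup.pi Set.univ (fun w : {w : {w : {w : InfinitePlace L // IsComplex w} // w ∉ S'} // w.1 ∉ E} => chartTorusGLoc L α w.1.1 S')) ρR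
            (isClosed_coe_pi _ fun w => isClosed_chartTorusGLoc L α w.1.1 S')
            (Measure.pi fun w : {w : {w : {w : InfinitePlace L // IsComplex w} // w ∉ S'} // w.1 ∉ E} => ν'w w.1.1)) := by
    refine MeasurePreserving.symm _ ⟨(quotientPiHomeomorph fun w : {w : {w : {w : InfinitePlace L // IsComplex w} // w ∉ S'} // w.1 ∉ E} => chartTorusGLoc L α w.1.1 S').toMeasurableEquiv.measurable, ?_⟩
    rw [Homeomorph.toMeasurableEquiv_coe]
    exact map_quotientPiHomeomorph_quotientMeasure_pi (fun w : {w : {w : {w : InfinitePlace L // IsComplex w} // w ∉ S'} // w.1 ∉ E} => chartTorusGLoc L α w.1.1 S')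
      (fun w => isClosed_chartTorusGLoc L α w.1.1 S') (fun w => t w.1.1) ρR hρR (fun w => ν'w w.1.1)
  refine ⟨MeasurableEquiv.prodCongr (MeasurableEquiv.refl _)
      ((MeasurableEquiv.piEquivPiSubtypeProd
          (fun w : {w : {w : InfinitePlace L // IsComplex w} // w ∉ S'} => ↥(archLocal L 3 (Matrix.diagonal α) w.1) ⧸ chartTorusGLoc L α w.1 S')
          (fun w : {w : {w : InfinitePlace L // IsComplex w} // w ∉ S'} => w.1 ∈ E)).trans
        (MeasurableEquiv.prodCongr (MeasurableEquiv.refl _)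
          (quotientPiHomeomorph fun w : {w : {w : {w : InfinitePlace L // IsComplex w} // w ∉ S'} // w.1 ∉ E} => chartTorusGLoc L α w.1.1 S').symm.toMeasurableEquiv)),
    (MeasurePreserving.id _).prod (((MeasurePreserving.id _).prod hqR).comp hsplit), fun x => ⟨rfl, rfl, rfl⟩⟩

omit [∀ w : {w : InfinitePlace L // IsComplex w}, MeasurableSpace ↥(archLocal L 3 (Matrix.diagonal α) w)]
  [∀ w : {w : InfinitePlace L // IsComplex w}, BorelSpace ↥(archLocal L 3 (Matrix.diagonal α) w)]
  [∀ w : {w : InfinitePlace L // IsComplex w}, LocallyCompactSpace ↥(archLocal L 3 (Matrix.diagonal α) w)]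
  [∀ w : {w : InfinitePlace L // IsComplex w}, SecondCountableTopology ↥(archLocal L 3 (Matrix.diagonal α) w)]
  [MeasurableSpace ↥(arch (↥(maximalRealSubfield L)) L (IsCMField.complexConj L) 3 (Matrix.diagonal α))]
  [BorelSpace ↥(arch (↥(maximalRealSubfield L)) L (IsCMField.complexConj L) 3 (Matrix.diagonal α))]
  [∀ w : {w : InfinitePlace L // IsComplex w}, MeasurableSpace (↥(archLocal L 3 (Matrix.diagonal α) w) ⧸ chartTorusGLoc L α w S')]
  [∀ w : {w : InfinitePlace L // IsComplex w}, BorelSpace (↥(archLocal L 3 (Matrix.diagonal α) w) ⧸ chartTorusGLoc L α w S')]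
  [MeasurableSpace ((∀ w : {w : {w : {w : InfinitePlace L // IsComplex w} // w ∉ S'} // w.1 ∉ E}, ↥(archLocal L 3 (Matrix.diagonal α) w.1.1)) ⧸
            Subgroup.pi Set.univ (fun w : {w : {w : {w : InfinitePlace L // IsComplex w} // w ∉ S'} // w.1 ∉ E} => chartTorusGLoc L α w.1.1 S'))]
  [BorelSpace ((∀ w : {w : {w : {w : InfinitePlace L // IsComplex w} // w ∉ S'} // w.1 ∉ E}, ↥(archLocal L 3 (Matrix.diagonal α) w.1.1)) ⧸
            Subgroup.pi Set.univ (fun w : {w : {w : {w : InfinitePlace L // IsComplex w} // w ∉ S'} // w.1 ∉ E} => chartTorusGLoc L α w.1.1 S'))] in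
/-- **THE HELD-OUT READING OF A POINT, `E`-SLOTS LOCAL** (pure bookkeeping): for classes `x₁` at the split places and `x₂` at the compact places, the (A1) §2 point
`(w ↦ z_w γ_w(c) z_w⁻¹)` EQUALS `w ↦ [w ∈ S′] x₁,w γ_w x₁,w⁻¹ ∣ [w ∈ E] x₂,w γ_w x₂,w⁻¹ ∣ [else] (G_R γ_R(c) G_R⁻¹)_w` with `G_R M_R = qπ_R⁻¹ (x₂|_R)` (★ `quotientPiEquiv_mk`, ★ `descConj_mk`).
[cite: Rogawski1990, §8.2 p. 122] -/
theorem heldOutFinsetPi_point_eq (c : {w : InfinitePlace L // IsComplex w} → Fin 3 → ℝ)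
    (x₁ : ∀ w : {w : {w : InfinitePlace L // IsComplex w} // w ∈ S'}, ↥(archLocal L 3 (Matrix.diagonal α) w.1) ⧸ chartTorusGLoc L α w.1 S')
    (x₂ : ∀ w : {w : {w : InfinitePlace L // IsComplex w} // w ∉ S'}, ↥(archLocal L 3 (Matrix.diagonal α) w.1) ⧸ chartTorusGLoc L α w.1 S') :
    (fun w : {w : InfinitePlace L // IsComplex w} =>
      descConj (gprimeBlockAt L α w S' (c w)) (chartTorusGLoc L α w S') (forall_mem_chartTorusGLoc_comm L α w S' (c w)) id
        (if h : w ∈ S' then x₁ ⟨w, h⟩ else x₂ ⟨w, h⟩)) =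
      fun w =>
            if h : w ∈ S' then
              descConj (gprimeBlockAt L α w S' (c w)) (chartTorusGLoc L α w S') (forall_mem_chartTorusGLoc_comm L α w S' (c w)) id (x₁ ⟨w, h⟩)
            else if hE : w ∈ E then
              descConj (gprimeBlockAt L α w S' (c w)) (chartTorusGLoc L α w S') (forall_mem_chartTorusGLoc_comm L α w S' (c w)) id ((fun w : {w : {w : {w : InfinitePlace L // IsComplex w} // w ∉ S'} // w.1 ∈ E} => x₂ w.1) ⟨⟨w, h⟩, hE⟩)
            else
              descConj (fun w : {w : {w : {w : InfinitePlace L // IsComplex w} // w ∉ S'} // w.1 ∉ E} => gprimeBlock L α w.1.1 S' c)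
                (Subgroup.pi Set.univ (fun w : {w : {w : {w : InfinitePlace L // IsComplex w} // w ∉ S'} // w.1 ∉ E} => chartTorusGLoc L α w.1.1 S'))
                (forall_mem_pi_chartTorusGLoc_comm L α S' (fun w : {w : {w : {w : InfinitePlace L // IsComplex w} // w ∉ S'} // w.1 ∉ E} => w.1.1) c)
                (fun g => (g ⟨⟨w, h⟩, hE⟩ : ↥(archLocal L 3 (Matrix.diagonal α) w))) ((quotientPiHomeomorph fun w : {w : {w : {w : InfinitePlace L // IsComplex w} // w ∉ S'} // w.1 ∉ E} => chartTorusGLoc L α w.1.1 S').symm (fun w : {w : {w : {w : InfinitePlace L // IsComplex w} // w ∉ S'} // w.1 ∉ E} => x₂ w.1)) := by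
  obtain ⟨GR, hGR⟩ := QuotientGroup.mk_surjective ((quotientPiHomeomorph fun w : {w : {w : {w : InfinitePlace L // IsComplex w} // w ∉ S'} // w.1 ∉ E} => chartTorusGLoc L α w.1.1 S').symm (fun w : {w : {w : {w : InfinitePlace L // IsComplex w} // w ∉ S'} // w.1 ∉ E} => x₂ w.1))
  have hzR : ∀ (w : {w : InfinitePlace L // IsComplex w}) (h : w ∉ S') (hE : w ∉ E),
      x₂ ⟨w, h⟩ = (quotientPiHomeomorph fun w : {w : {w : {w : InfinitePlace L // IsComplex w} // w ∉ S'} // w.1 ∉ E} => chartTorusGLoc L α w.1.1 S') (QuotientGroup.mk GR) ⟨⟨w, h⟩, hE⟩ := by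
    intro w h hE
    have hGw := congrFun (congrArg (quotientPiHomeomorph fun w : {w : {w : {w : InfinitePlace L // IsComplex w} // w ∉ S'} // w.1 ∉ E} => chartTorusGLoc L α w.1.1 S') hGR) ⟨⟨w, h⟩, hE⟩
    rw [Homeomorph.apply_symm_apply] at hGw
    exact hGw.symm
  rw [← hGR]
  funext w
  by_cases h : w ∈ S'
  · rw [dif_pos h, dif_pos h]
  · by_cases hE : w ∈ E
    · rw [dif_neg h, dif_neg h, dif_pos hE]
    · rw [dif_neg h, dif_neg h, dif_neg hE, hzR w h hE, descConj_mk, coe_quotientPiHomeomorph, quotientPiEquiv_mk, descConj_mk]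
      rfl

include hν hρR in
/-- **(A1′)^E, PRODUCT FORM — `chartOrbG` WITH A FINSET `E` HELD OUT AS `Π_{ιE} (U_w ⧸ T′_w)`, HYPOTHESIS-FREE.**  For admissible `S′` (`hα`, `hS′`), ANY inversion-invariant Haar
family `t_w`, ANY finset `E` of places and an inversion-invariant Haar `ρ_R` on `M_R := Π_{w ∉ S′, w ∉ E} T′_w` with coordinates `⊗ t_w` (`hρR`), EVERY `a′` and EVERY `c`:
`chartOrbG ν′ S′ a′ c = (∏_w t_w(B′_w)) · ∫ a′ (e⁻¹ (w ↦ [w ∈ S′] x_w γ_w(c) x_w⁻¹ ∣ [w ∈ E] z_w γ_w(c) z_w⁻¹ ∣ [else] (g γ_R(c) g⁻¹)_w)) d((⊗_{S′} q_w) ⊗ ((⊗_{ιE} q_w) ⊗ Q_R))(x, z, gM_R)` — the split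
AND the held-out places in LOCAL `descConj (γ_w(c)) T′_w _ id` currency (the held-out block is what L1^ι descends place by place), the rest through ONE `descConj (γ_R(c)) M_R _`.
★ (A1) §2 + `exists_measurableEquiv_heldOutFinsetPi` + `heldOutFinsetPi_point_eq`. [cite: Folland1995, §2.6 Thm. 2.49, (2.52)] [cite: Gelbart1975, p. 155 (10.19)] [cite: Rogawski1990, §8.2 p. 122; §8.3 p. 124] -/
theorem chartOrbG_eq_prod_mul_integral_pi_prod_heldOutFinsetPi (hα : ∀ i, α i ≠ 0) (hS' : ∀ w, w ∈ S' → w ∈ splitChartPlaces L α)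
    (a' : ↥(arch (↥(maximalRealSubfield L)) L (IsCMField.complexConj L) 3 (Matrix.diagonal α)) → ℂ)
    (c : {w : InfinitePlace L // IsComplex w} → Fin 3 → ℝ) :
    chartOrbG L α ν' S' a' c =
      (∏ w, ((t w (chartBoxImgGLoc L α w S')).toReal : ℂ)) *
        ∫ x : (∀ w : {w : {w : InfinitePlace L // IsComplex w} // w ∈ S'}, ↥(archLocal L 3 (Matrix.diagonal α) w.1) ⧸ chartTorusGLoc L α w.1 S') ×
            ((∀ w : {w : {w : {w : InfinitePlace L // IsComplex w} // w ∉ S'} // w.1 ∈ E}, ↥(archLocal L 3 (Matrix.diagonal α) w.1.1) ⧸ chartTorusGLoc L α w.1.1 S') ×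
              ((∀ w : {w : {w : {w : InfinitePlace L // IsComplex w} // w ∉ S'} // w.1 ∉ E}, ↥(archLocal L 3 (Matrix.diagonal α) w.1.1)) ⧸
            Subgroup.pi Set.univ (fun w : {w : {w : {w : InfinitePlace L // IsComplex w} // w ∉ S'} // w.1 ∉ E} => chartTorusGLoc L α w.1.1 S'))),
          a' ((archPiEquivCM 3 L (Matrix.diagonal α)).symm (fun w =>
            if h : w ∈ S' then
              descConj (gprimeBlockAt L α w S' (c w)) (chartTorusGLoc L α w S') (forall_mem_chartTorusGLoc_comm L α w S' (c w)) id (x.1 ⟨w, h⟩)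
            else if hE : w ∈ E then
              descConj (gprimeBlockAt L α w S' (c w)) (chartTorusGLoc L α w S') (forall_mem_chartTorusGLoc_comm L α w S' (c w)) id (x.2.1 ⟨⟨w, h⟩, hE⟩)
            else
              descConj (fun w : {w : {w : {w : InfinitePlace L // IsComplex w} // w ∉ S'} // w.1 ∉ E} => gprimeBlock L α w.1.1 S' c)
                (Subgroup.pi Set.univ (fun w : {w : {w : {w : InfinitePlace L // IsComplex w} // w ∉ S'} // w.1 ∉ E} => chartTorusGLoc L α w.1.1 S'))
                (forall_mem_pi_chartTorusGLoc_comm L α S' (fun w : {w : {w : {w : InfinitePlace L // IsComplex w} // w ∉ S'} // w.1 ∉ E} => w.1.1) c)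
                (fun g => (g ⟨⟨w, h⟩, hE⟩ : ↥(archLocal L 3 (Matrix.diagonal α) w))) x.2.2))
          ∂((Measure.pi fun w : {w : {w : InfinitePlace L // IsComplex w} // w ∈ S'} =>
          quotientMeasure (chartTorusGLoc L α w.1 S') (t w.1) (isClosed_chartTorusGLoc L α w.1 S') (ν'w w.1)).prod
        ((Measure.pi fun w : {w : {w : {w : InfinitePlace L // IsComplex w} // w ∉ S'} // w.1 ∈ E} =>
            quotientMeasure (chartTorusGLoc L α w.1.1 S') (t w.1.1) (isClosed_chartTorusGLoc L α w.1.1 S') (ν'w w.1.1)).prod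
          (quotientMeasure (Subgroup.pi Set.univ (fun w : {w : {w : {w : InfinitePlace L // IsComplex w} // w ∉ S'} // w.1 ∉ E} => chartTorusGLoc L α w.1.1 S')) ρR
            (isClosed_coe_pi _ fun w => isClosed_chartTorusGLoc L α w.1.1 S')
            (Measure.pi fun w : {w : {w : {w : InfinitePlace L // IsComplex w} // w ∉ S'} // w.1 ∉ E} => ν'w w.1.1)))) := by
  haveI : ∀ w : {w : InfinitePlace L // IsComplex w}, SecondCountableTopology (↥(archLocal L 3 (Matrix.diagonal α) w) ⧸ chartTorusGLoc L α w S') := fun w => inferInstance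
  haveI : ∀ w : {w : InfinitePlace L // IsComplex w},
      SigmaFinite (quotientMeasure (chartTorusGLoc L α w S') (t w) (isClosed_chartTorusGLoc L α w S') (ν'w w)) := fun w => inferInstance
  rw [chartOrbG_eq_prod_mul_integral_prod_pi L α S' ν'w ν' hν t hα hS' a' c]
  congr 1
  obtain ⟨Φ, hΦ, hΦx⟩ := exists_measurableEquiv_heldOutFinsetPi L α S' ν'w t E ρR hρR
  rw [← hΦ.integral_comp' (f := Φ)]
  refine integral_congr_ae (Filter.Eventually.of_forall fun x => ?_)
  obtain ⟨x₁, x₂⟩ := x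
  obtain ⟨h1, h2, h3⟩ := hΦx (x₁, x₂)
  dsimp only
  rw [h1, h2, h3, heldOutFinsetPi_point_eq L α S' E c x₁ x₂]

/-! ## §2 At a `G`-regular point: integrability and the ITERATED form, the held-out local quotients OUTSIDE -/
include hν hρR in
/-- **The product-form held-out integrand of §1 is integrable at every `G`-REGULAR `c` for `a′ ∈ C_c(G′_∞)`** — ★ (A1) `integrable_comp_symm_archPiEquivCM_descConj_pi_of_regG`
transported along Mathlib `piEquivPiSubtypeProd` and the held-out coordinates `Φ`. [cite: Rogawski1990, §8.3 p. 122] [cite: DeitmarEchterhoff2014, Lemma 9.3.3] -/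
theorem integrable_heldOutFinsetPi_of_regG (hα : ∀ i, α i ≠ 0) (hS' : ∀ w, w ∈ S' → w ∈ splitChartPlaces L α)
    {c : {w : InfinitePlace L // IsComplex w} → Fin 3 → ℝ} (hc : c ∈ RegG S')
    {a' : ↥(arch (↥(maximalRealSubfield L)) L (IsCMField.complexConj L) 3 (Matrix.diagonal α)) → ℂ} (ha'c : Continuous a') (ha's : HasCompactSupport a') :
    Integrable (fun x : (∀ w : {w : {w : InfinitePlace L // IsComplex w} // w ∈ S'}, ↥(archLocal L 3 (Matrix.diagonal α) w.1) ⧸ chartTorusGLoc L α w.1 S') ×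
            ((∀ w : {w : {w : {w : InfinitePlace L // IsComplex w} // w ∉ S'} // w.1 ∈ E}, ↥(archLocal L 3 (Matrix.diagonal α) w.1.1) ⧸ chartTorusGLoc L α w.1.1 S') ×
              ((∀ w : {w : {w : {w : InfinitePlace L // IsComplex w} // w ∉ S'} // w.1 ∉ E}, ↥(archLocal L 3 (Matrix.diagonal α) w.1.1)) ⧸
            Subgroup.pi Set.univ (fun w : {w : {w : {w : InfinitePlace L // IsComplex w} // w ∉ S'} // w.1 ∉ E} => chartTorusGLoc L α w.1.1 S'))) =>
          a' ((archPiEquivCM 3 L (Matrix.diagonal α)).symm (fun w =>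
            if h : w ∈ S' then
              descConj (gprimeBlockAt L α w S' (c w)) (chartTorusGLoc L α w S') (forall_mem_chartTorusGLoc_comm L α w S' (c w)) id (x.1 ⟨w, h⟩)
            else if hE : w ∈ E then
              descConj (gprimeBlockAt L α w S' (c w)) (chartTorusGLoc L α w S') (forall_mem_chartTorusGLoc_comm L α w S' (c w)) id (x.2.1 ⟨⟨w, h⟩, hE⟩)
            else
              descConj (fun w : {w : {w : {w : InfinitePlace L // IsComplex w} // w ∉ S'} // w.1 ∉ E} => gprimeBlock L α w.1.1 S' c)
                (Subgroup.pi Set.univ (fun w : {w : {w : {w : InfinitePlace L // IsComplex w} // w ∉ S'} // w.1 ∉ E} => chartTorusGLoc L α w.1.1 S'))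
                (forall_mem_pi_chartTorusGLoc_comm L α S' (fun w : {w : {w : {w : InfinitePlace L // IsComplex w} // w ∉ S'} // w.1 ∉ E} => w.1.1) c)
                (fun g => (g ⟨⟨w, h⟩, hE⟩ : ↥(archLocal L 3 (Matrix.diagonal α) w))) x.2.2)))
      ((Measure.pi fun w : {w : {w : InfinitePlace L // IsComplex w} // w ∈ S'} =>
          quotientMeasure (chartTorusGLoc L α w.1 S') (t w.1) (isClosed_chartTorusGLoc L α w.1 S') (ν'w w.1)).prod
        ((Measure.pi fun w : {w : {w : {w : InfinitePlace L // IsComplex w} // w ∉ S'} // w.1 ∈ E} =>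
            quotientMeasure (chartTorusGLoc L α w.1.1 S') (t w.1.1) (isClosed_chartTorusGLoc L α w.1.1 S') (ν'w w.1.1)).prod
          (quotientMeasure (Subgroup.pi Set.univ (fun w : {w : {w : {w : InfinitePlace L // IsComplex w} // w ∉ S'} // w.1 ∉ E} => chartTorusGLoc L α w.1.1 S')) ρR
            (isClosed_coe_pi _ fun w => isClosed_chartTorusGLoc L α w.1.1 S')
            (Measure.pi fun w : {w : {w : {w : InfinitePlace L // IsComplex w} // w ∉ S'} // w.1 ∉ E} => ν'w w.1.1)))) := by
  haveI : ∀ w : {w : InfinitePlace L // IsComplex w}, SecondCountableTopology (↥(archLocal L 3 (Matrix.diagonal α) w) ⧸ chartTorusGLoc L α w S') := fun w => inferInstance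
  haveI : ∀ w : {w : InfinitePlace L // IsComplex w},
      SigmaFinite (quotientMeasure (chartTorusGLoc L α w S') (t w) (isClosed_chartTorusGLoc L α w S') (ν'w w)) := fun w => inferInstance
  obtain ⟨Φ, hΦ, hΦx⟩ := exists_measurableEquiv_heldOutFinsetPi L α S' ν'w t E ρR hρR
  rw [← hΦ.integrable_comp_emb Φ.measurableEmbedding]
  have hmp := (measurePreserving_piEquivPiSubtypeProd'
    (fun w : {w : InfinitePlace L // IsComplex w} => quotientMeasure (chartTorusGLoc L α w S') (t w) (isClosed_chartTorusGLoc L α w S') (ν'w w))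
    (fun w => w ∈ S')).symm
    (MeasurableEquiv.piEquivPiSubtypeProd (fun w : {w : InfinitePlace L // IsComplex w} => ↥(archLocal L 3 (Matrix.diagonal α) w) ⧸ chartTorusGLoc L α w S')
      (fun w => w ∈ S'))
  have hint := (hmp.integrable_comp_emb (MeasurableEquiv.measurableEmbedding _)).2
    (integrable_comp_symm_archPiEquivCM_descConj_pi_of_regG L α S' ν'w ν' hν t hα hS' hc ha'c ha's)
  refine hint.congr (Filter.Eventually.of_forall fun x => ?_)
  obtain ⟨x₁, x₂⟩ := x
  obtain ⟨h1, h2, h3⟩ := hΦx (x₁, x₂)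
  simp only [Function.comp_apply]
  rw [h1, h2, h3, ← heldOutFinsetPi_point_eq L α S' E c x₁ x₂]
  rfl

include hν hρR in
/-- **(A1′)^E ITERATED, PRODUCT FORM — the held-out local quotients OUTSIDE** (Fubini on §1 after ★ `integral_prod_prodLeftComm`; integrability from
`integrable_heldOutFinsetPi_of_regG`): for admissible `S′`, `c ∈ RegG S′`, `a′ ∈ C_c(G′_∞)`,
`chartOrbG ν′ S′ a′ c = (∏_w t_w(B′_w)) · ∫_{Π_{ιE} (U_w⧸T′_w)} ( ∫_{(Π_{S′} U⧸T′) × X_R} a′ (e⁻¹ (…)) d((⊗_{S′} q_w) ⊗ Q_R) ) d(⊗_{ιE} q_w)(z)` — the outer integral is exactly the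
LEFT-HAND SIDE SHAPE of L1^ι `exists_descent_box_local_param_pi` (`ι := ιE`, `e := fun w => w.1.1`). [cite: Rogawski1990, §8.2 p. 122; §8.3 pp. 122–124] [cite: Folland1995, §2.6 (2.52)]
[cite: DeitmarEchterhoff2014, Lemma 9.3.3] -/
theorem chartOrbG_eq_prod_mul_integral_integral_heldOutFinsetPi_of_regG (hα : ∀ i, α i ≠ 0) (hS' : ∀ w, w ∈ S' → w ∈ splitChartPlaces L α)
    {c : {w : InfinitePlace L // IsComplex w} → Fin 3 → ℝ} (hc : c ∈ RegG S')
    {a' : ↥(arch (↥(maximalRealSubfield L)) L (IsCMField.complexConj L) 3 (Matrix.diagonal α)) → ℂ} (ha'c : Continuous a') (ha's : HasCompactSupport a') :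
    chartOrbG L α ν' S' a' c =
      (∏ w, ((t w (chartBoxImgGLoc L α w S')).toReal : ℂ)) *
        ∫ z : (∀ w : {w : {w : {w : InfinitePlace L // IsComplex w} // w ∉ S'} // w.1 ∈ E}, ↥(archLocal L 3 (Matrix.diagonal α) w.1.1) ⧸ chartTorusGLoc L α w.1.1 S'),
          (∫ p : (∀ w : {w : {w : InfinitePlace L // IsComplex w} // w ∈ S'}, ↥(archLocal L 3 (Matrix.diagonal α) w.1) ⧸ chartTorusGLoc L α w.1 S') ×
              ((∀ w : {w : {w : {w : InfinitePlace L // IsComplex w} // w ∉ S'} // w.1 ∉ E}, ↥(archLocal L 3 (Matrix.diagonal α) w.1.1)) ⧸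
            Subgroup.pi Set.univ (fun w : {w : {w : {w : InfinitePlace L // IsComplex w} // w ∉ S'} // w.1 ∉ E} => chartTorusGLoc L α w.1.1 S')),
            a' ((archPiEquivCM 3 L (Matrix.diagonal α)).symm (fun w =>
            if h : w ∈ S' then
              descConj (gprimeBlockAt L α w S' (c w)) (chartTorusGLoc L α w S') (forall_mem_chartTorusGLoc_comm L α w S' (c w)) id (p.1 ⟨w, h⟩)
            else if hE : w ∈ E then
              descConj (gprimeBlockAt L α w S' (c w)) (chartTorusGLoc L α w S') (forall_mem_chartTorusGLoc_comm L α w S' (c w)) id (z ⟨⟨w, h⟩, hE⟩)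
            else
              descConj (fun w : {w : {w : {w : InfinitePlace L // IsComplex w} // w ∉ S'} // w.1 ∉ E} => gprimeBlock L α w.1.1 S' c)
                (Subgroup.pi Set.univ (fun w : {w : {w : {w : InfinitePlace L // IsComplex w} // w ∉ S'} // w.1 ∉ E} => chartTorusGLoc L α w.1.1 S'))
                (forall_mem_pi_chartTorusGLoc_comm L α S' (fun w : {w : {w : {w : InfinitePlace L // IsComplex w} // w ∉ S'} // w.1 ∉ E} => w.1.1) c)
                (fun g => (g ⟨⟨w, h⟩, hE⟩ : ↥(archLocal L 3 (Matrix.diagonal α) w))) p.2))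
            ∂((Measure.pi fun w : {w : {w : InfinitePlace L // IsComplex w} // w ∈ S'} =>
                quotientMeasure (chartTorusGLoc L α w.1 S') (t w.1) (isClosed_chartTorusGLoc L α w.1 S') (ν'w w.1)).prod
              (quotientMeasure (Subgroup.pi Set.univ (fun w : {w : {w : {w : InfinitePlace L // IsComplex w} // w ∉ S'} // w.1 ∉ E} => chartTorusGLoc L α w.1.1 S')) ρR
            (isClosed_coe_pi _ fun w => isClosed_chartTorusGLoc L α w.1.1 S')
            (Measure.pi fun w : {w : {w : {w : InfinitePlace L // IsComplex w} // w ∉ S'} // w.1 ∉ E} => ν'w w.1.1))))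
          ∂(Measure.pi fun w : {w : {w : {w : InfinitePlace L // IsComplex w} // w ∉ S'} // w.1 ∈ E} =>
            quotientMeasure (chartTorusGLoc L α w.1.1 S') (t w.1.1) (isClosed_chartTorusGLoc L α w.1.1 S') (ν'w w.1.1)) := by
  haveI : ∀ w : {w : InfinitePlace L // IsComplex w}, SecondCountableTopology (↥(archLocal L 3 (Matrix.diagonal α) w) ⧸ chartTorusGLoc L α w S') := fun w => inferInstance
  haveI : ∀ w : {w : InfinitePlace L // IsComplex w},
      SigmaFinite (quotientMeasure (chartTorusGLoc L α w S') (t w) (isClosed_chartTorusGLoc L α w S') (ν'w w)) := fun w => inferInstance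
  have hMcR : IsClosed ((Subgroup.pi Set.univ (fun w : {w : {w : {w : InfinitePlace L // IsComplex w} // w ∉ S'} // w.1 ∉ E} => chartTorusGLoc L α w.1.1 S')) :
      Set (∀ w : {w : {w : {w : InfinitePlace L // IsComplex w} // w ∉ S'} // w.1 ∉ E}, ↥(archLocal L 3 (Matrix.diagonal α) w.1.1))) :=
    isClosed_coe_pi _ fun w => isClosed_chartTorusGLoc L α w.1.1 S'
  haveI : LocallyCompactSpace ↥(Subgroup.pi Set.univ (fun w : {w : {w : {w : InfinitePlace L // IsComplex w} // w ∉ S'} // w.1 ∉ E} => chartTorusGLoc L α w.1.1 S')) :=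
    hMcR.isClosedEmbedding_subtypeVal.locallyCompactSpace
  haveI : SecondCountableTopology ↥(Subgroup.pi Set.univ (fun w : {w : {w : {w : InfinitePlace L // IsComplex w} // w ∉ S'} // w.1 ∉ E} => chartTorusGLoc L α w.1.1 S')) :=
    TopologicalSpace.Subtype.secondCountableTopology _
  haveI : SFinite ρR := inferInstance
  rw [chartOrbG_eq_prod_mul_integral_pi_prod_heldOutFinsetPi L α S' ν'w ν' hν t E ρR hρR hα hS' a' c, integral_prod_prodLeftComm]
  congr 1
  rw [integral_prod _ ((integrable_prodLeftComm_iff _ _ _ _).2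
    (integrable_heldOutFinsetPi_of_regG L α S' ν'w ν' hν t E ρR hρR hα hS' hc ha'c ha's))]

end HeldOutFinsetPi
end Literature.NumberTheory.Automorphic.UnitaryGroup
end
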